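import Summits.CriticalPhenomena.PercolationContinuityZ3.Theorems.Transplant.SkelFrmBChoiceRootRunY
import HarnessLib

/-!
# N2 (frames-only node `SamePDropOfSkeletonFrm₁`, OPEN), (R) column SECOND axis — **THE ROOT y′-ARRIVAL BOX AGAINST (C)'s, ALONG BOTTOM**:
# `Skelφ.KGYRows.kgM₂Y_sub_mul_le` (cell-free: `dec₂Y·((m₂Y(W′)+1) − (m₂Y(W)+1)) ≤ (TY(W′) − TY(W)) + dec₂Y − 1` for `W ≤ W′` — ceilings and the
# `max 1` are 1-Lipschitz), `KS.dm₁Y_R_le` (`(m₁Y^C+1) − (m₁Y^R+1) ≤ 275`), `KS.XY_sub_R_le` (`XY^C − XY^R ≤ 276·R′0 ≤ sL`), and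
# **`KS.rootBoxY_bottom_R`** (`arrLo₁^C − sL ≤ lo₁^R`) — with SkelFrmBChoiceRootBoxY the root's arrival box sits inside (C)'s widened by
# `(2n_L, n_L)` across and `(sL, 0)` along, i.e. inside the hypotheses of stmt's `hLtY_W_box/hLlY_W_box`.
builds on p205010 (kernel theorem, internal audit signed; external expert review pending) — nothing in this file uses p205010; nothing here is a
claim about the open node `SamePDropOfSkeletonFrm₁`.
Lane `prim-bschramm`, seat `prim-bschramm-p3` (gen 17; (R) lineage); helper file (`--supports stmt-CriticalPhenomena-4575 --as helper`).
[cite: KozmaNitzan2024, §4 Lemma 12 (pp. 23–25: the target box)]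
-/

noncomputable section

open scoped Classical

namespace Summit.CriticalPhenomena.PercolationContinuityZ3.Theorems.Transplant

namespace Skelφ

open Literature.Probability.Percolation Literature.Probability.LatticeModels SimpleGraph

section M2

variable {n ℓ : ℕ} {hs v : ℤ} {R' ρ q W q' W' : ℕ}

/-- **The growth of `m₂Y + 1` with the window is controlled by `TY`**: `dec₂Y·((m₂Y(q′,W′)+1) − (m₂Y(q,W)+1)) ≤ (TY(q′,W′) − TY(q,W)) + dec₂Y − 1`
for `q ≤ q′`, `W ≤ W′` (`m₂Y + 1 = max 1 ⌈(TY − P′)/dec₂Y⌉`; the ceiling and `max 1 ·` are monotone and 1-Lipschitz). [this work] -/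
theorem KGYRows.kgM₂Y_sub_mul_le (H : KGYRows n ℓ hs v R' ρ q W) (H' : KGYRows n ℓ hs v R' ρ q' W') (hq : q ≤ q') (hW : W ≤ W') (N : ℕ) :
    kgDec₂Y n ℓ hs R' ρ * ((((kgM₂Y n ℓ hs v R' ρ q' W' N : ℕ) : ℤ) + 1) - (((kgM₂Y n ℓ hs v R' ρ q W N : ℕ) : ℤ) + 1)) ≤
      (kgTY n ℓ hs v R' ρ q' W' N - kgTY n ℓ hs v R' ρ q W N) + kgDec₂Y n ℓ hs R' ρ - 1 := by
  have hd0 : 0 < kgDec₂Y n ℓ hs R' ρ := by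
    have := H.dec₂_pos; have : (0 : ℤ) ≤ R' := by positivity
    have : (0 : ℤ) ≤ ρ := by positivity
    linarith
  obtain ⟨he, -⟩ := H.kgM₂Y_spec N
  obtain ⟨he', -⟩ := H'.kgM₂Y_spec N
  have hT := H.kgTY_mono_qW hq hW N
  set d := kgDec₂Y n ℓ hs R' ρ with hd
  set P' := ((n : ℤ) * ℓ / (shearUnit n hs : ℕ) + 1 + ρ - 1) with hP'
  set T := kgTY n ℓ hs v R' ρ q W N with hTdef
  set T' := kgTY n ℓ hs v R' ρ q' W' N with hT'def
  set c := (T - P' + d - 1) / d with hc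
  set c' := (T' - P' + d - 1) / d with hc'
  rw [he, he']
  -- d·(c' − c) ≤ (T' − T) + d − 1
  have h1 := Int.ediv_mul_le (T' - P' + d - 1) (ne_of_gt hd0)
  have h2 := Int.lt_ediv_add_one_mul_self (T - P' + d - 1) hd0
  rw [← hc'] at h1
  rw [← hc] at h2
  have hcc : d * (c' - c) ≤ (T' - T) + d - 1 := by nlinarith
  have hmono : c ≤ c' := Int.ediv_le_ediv hd0 (by linarith)
  -- case analysis on `max 1`
  rcases le_or_gt 1 c with hc1 | hc1
  · rw [max_eq_right hc1, max_eq_right (hc1.trans hmono)]; exact hcc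
  · rw [max_eq_left hc1.le]
    rcases le_or_gt 1 c' with hc1' | hc1'
    · rw [max_eq_right hc1']
      have : d * (c' - 1) ≤ d * (c' - c) := by
        apply mul_le_mul_of_nonneg_left _ hd0.le; linarith
      linarith
    · rw [max_eq_left hc1'.le]
      have : (0 : ℤ) ≤ T' - T := by linarith
      nlinarith

end M2

end Skelφ

namespace PlanarSkeletonFrm

namespace NegB

open Literature.Probability.Percolation Literature.Probability.LatticeModels SimpleGraph
open SkelConc (Consts)
open Skelφ (shearUnit kgSL kgSLY KGYRows kgXY kgTY kgM₁Y kgM₂Y kgDec₁Y kgDec₂Y)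
open Neg

namespace KS

section BoxY2

variable (κ : Consts) {V : Type} [DecidableEq V] [Countable V] {G : SimpleGraph V} [G.LocallyFinite] (Φ : PlanarSkeletonFrm G) (t : V) (p : unitInterval)
  (D : Skelφ.StepI.DataNS V) (mk g f qxY WxY : ℕ)

/-- **`0 ≤ m₁Y^C − m₁Y^R ≤ 274`** at `N = kgNYv0` (`dec₁Y·Δm₁ ≤ 2·X2R + dec₁Y − 1`, `2·X2R ≤ 137·n_L − 1`, `2·dec₁Y ≥ n_L + 2`). [this work] -/
theorem dm₁Y_R_le (hN : EqNumL κ Φ t p D g f) (hg : gFloorKG κ Φ t p D mk ≤ g) (hg2 : 40 * Neg.K κ * KS0.R'0 κ Φ t p D mk ≤ g)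
    (hf : KS.fxR0 κ Φ t p D mk ≤ f) (hWxY : KS.Rs t D mk + 34 * nL κ Φ t p D g f + 29 * KS0.R'0 κ Φ t p D mk + 2 ≤ WxY) (hWx : WxY ≤ 100 * nL κ Φ t p D g f) :
    0 ≤ ((((kgM₁Y (nL κ Φ t p D g f) (vL κ Φ t p D g f) (kgR κ Φ t p D mk) 0 (kgWY κ Φ t p D g f WxY) (kgNYv0 κ Φ t p D g f mk qxY WxY))) : ℕ) : ℤ) - ((((kgM₁Y (nL κ Φ t p D g f) (vL κ Φ t p D g f) (kgR κ Φ t p D mk) 0 (kgWY κ Φ t p D g f (KS.WxYR κ Φ t p D mk g f WxY)) (kgNYv0 κ Φ t p D g f mk qxY WxY))) : ℕ) : ℤ) ∧ ((((kgM₁Y (nL κ Φ t p D g f) (vL κ Φ t p D g f) (kgR κ Φ t p D mk) 0 (kgWY κ Φ t p D g f WxY) (kgNYv0 κ Φ t p D g f mk qxY WxY))) : ℕ) : ℤ) - ((((kgM₁Y (nL κ Φ t p D g f) (vL κ Φ t p D g f) (kgR κ Φ t p D mk) 0 (kgWY κ Φ t p D g f (KS.WxYR κ Φ t p D mk g f WxY))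 (kgNYv0 κ Φ t p D g f mk qxY WxY))) : ℕ) : ℤ) ≤ 274 := by
  have HC := (kgYRows0_of κ Φ t p D g f mk qxY WxY hN hg)
  have HR := (kgYRows0_of κ Φ t p D g f mk qxY (KS.WxYR κ Φ t p D mk g f WxY) hN hg)
  have hm := HR.kgM₁Y_sub_mul_le HC (kgNYv0 κ Φ t p D g f mk qxY WxY)
  have hmono := HR.kgM₁Y_monoW (kgWY_R_le κ Φ t p D mk g f WxY) (kgNYv0 κ Φ t p D g f mk qxY WxY)
  have hmono' : ((((kgM₁Y (nL κ Φ t p D g f) (vL κ Φ t p D g f) (kgR κ Φ t p D mk) 0 (kgWY κ Φ t p D g f (KS.WxYR κ Φ t p D mk g f WxY)) (kgNYv0 κ Φ t p D g f mk qxY WxY))) : ℕ) : ℤ) ≤ ((((kgM₁Y (nL κ Φ t p D g f) (vL κ Φ t p D g f) (kgR κ Φ t p D mk) 0 (kgWY κ Φ t p D g f WxY) (kgNYv0 κ Φ t p D g f mk qxY WxY))) : ℕ) : ℤ) := by exact_mod_cast hmono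
  obtain ⟨-, hsum⟩ := X2R_add_WxYR κ Φ t p D mk g f WxY hWxY
  obtain ⟨hKR, -, -, hR1, hK, -⟩ := valsQ_floor κ Φ t p D g f mk hN hg hg2
  have eR : (kgR κ Φ t p D mk) = (KS0.R'0 κ Φ t p D mk) := rfl
  have hX2 : 2 * (((KS.X2R κ Φ t p D mk g f WxY) : ℕ) : ℤ) ≤ (WxY : ℤ) + (KS.Rs t D mk : ℕ) + 34 * (nL κ Φ t p D g f : ℤ) + 29 * (((KS0.R'0 κ Φ t p D mk) : ℕ) : ℤ) + 2 := by
    have : 2 * (KS.X2R κ Φ t p D mk g f WxY) ≤ WxY + KS.Rs t D mk + 34 * (nL κ Φ t p D g f) + 29 * (KS0.R'0 κ Φ t p D mk) + 2 := by unfold KS.X2R; omega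
    exact_mod_cast this
  have hRs : ((KS.Rs t D mk : ℕ) : ℤ) + 1 ≤ (nL κ Φ t p D g f : ℤ) := by
    have hfn := hf.trans (n₁L_le_nL κ Φ t p D g f).2
    rw [KS.fxR0_eq] at hfn
    have : KS.Rs t D mk + 1 ≤ (nL κ Φ t p D g f) := by omega
    exact_mod_cast this
  have hWx' : ((WxY : ℕ) : ℤ) ≤ 100 * (nL κ Φ t p D g f : ℤ) := by exact_mod_cast hWx
  have h1600 : 1600 * (((KS0.R'0 κ Φ t p D mk) : ℕ) : ℤ) + 1 ≤ (nL κ Φ t p D g f : ℤ) := by nlinarith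
  have hd : (kgDec₁Y (nL κ Φ t p D g f) (kgR κ Φ t p D mk) 0) = (nL κ Φ t p D g f : ℤ) - 2 * (((kgR κ Φ t p D mk) : ℕ) : ℤ) - ((0 : ℕ) : ℤ) := rfl
  rw [hd, eR] at hm
  push_cast at hm hsum
  have hΔeq : ((((kgM₁Y (nL κ Φ t p D g f) (vL κ Φ t p D g f) (KS0.R'0 κ Φ t p D mk) 0 (kgWY κ Φ t p D g f WxY) (kgNYv0 κ Φ t p D g f mk qxY WxY))) : ℕ) : ℤ) - ((((kgM₁Y (nL κ Φ t p D g f) (vL κ Φ t p D g f) (KS0.R'0 κ Φ t p D mk) 0 (kgWY κ Φ t p D g f (KS.WxYR κ Φ t p D mk g f WxY)) (kgNYv0 κ Φ t p D g f mk qxY WxY))) : ℕ) : ℤ) ≤ 274 := by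
    have hpos : 0 < (nL κ Φ t p D g f : ℤ) - 2 * (((KS0.R'0 κ Φ t p D mk) : ℕ) : ℤ) := by linarith
    have hlt : ((nL κ Φ t p D g f : ℤ) - 2 * (((KS0.R'0 κ Φ t p D mk) : ℕ) : ℤ)) * ((((((kgM₁Y (nL κ Φ t p D g f) (vL κ Φ t p D g f) (KS0.R'0 κ Φ t p D mk) 0 (kgWY κ Φ t p D g f WxY) (kgNYv0 κ Φ t p D g f mk qxY WxY))) : ℕ) : ℤ) - ((((kgM₁Y (nL κ Φ t p D g f) (vL κ Φ t p D g f) (KS0.R'0 κ Φ t p D mk) 0 (kgWY κ Φ t p D g f (KS.WxYR κ Φ t p D mk g f WxY)) (kgNYv0 κ Φ t p D g f mk qxY WxY))) : ℕ) : ℤ)) - 1) <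
        ((nL κ Φ t p D g f : ℤ) - 2 * (((KS0.R'0 κ Φ t p D mk) : ℕ) : ℤ)) * 274 := by nlinarith
    have := lt_of_mul_lt_mul_left hlt hpos.le
    linarith
  exact ⟨by linarith, hΔeq⟩

/-- **`XY^C − XY^R ≤ 275·R′0 ≤ sL`** at `N = kgNYv0` (`Δm₁Y ≤ 274`, `Δm₂Y ≤ 1` because `2·274·R′0 < dec₂Y`). [this work] -/
theorem XY_sub_R_le (hN : EqNumL κ Φ t p D g f) (hg : gFloorKG κ Φ t p D mk ≤ g) (hg2 : 40 * Neg.K κ * KS0.R'0 κ Φ t p D mk ≤ g)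
    (hf : KS.fxR0 κ Φ t p D mk ≤ f) (hWxY : KS.Rs t D mk + 34 * nL κ Φ t p D g f + 29 * KS0.R'0 κ Φ t p D mk + 2 ≤ WxY) (hWx : WxY ≤ 100 * nL κ Φ t p D g f) :
    0 ≤ (kgXY (nL κ Φ t p D g f) (ℓL κ Φ t p D g f) (hL κ Φ t p D g f) (vL κ Φ t p D g f) (kgR κ Φ t p D mk) 0 (kgqY κ Φ t p D g f qxY) (kgWY κ Φ t p D g f WxY) (kgNYv0 κ Φ t p D g f mk qxY WxY)) - (kgXY (nL κ Φ t p D g f) (ℓL κ Φ t p D g f) (hL κ Φ t p D g f) (vL κ Φ t p D g f) (kgR κ Φ t p D mk) 0 (kgqY κ Φ t p D g f qxY) (kgWY κ Φ t p D g f (KS.WxYR κ Φ t p D mk g f WxY)) (kgNYv0 κ Φ t p D g f mk qxY WxY)) ∧ (kgXY (nL κ Φ t p D g f) (ℓL κ Φ t p D g f) (hL κ Φ t p D g f) (vL κ Φ t p D g f) (kgR κ Φ t p D mk) 0 (kgqY κ Φ t p D g f qxY) (kgWY κ Φ t p D g f WxY) (kgNYv0 κ Φ t p D g f mk qxY WxY))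 - (kgXY (nL κ Φ t p D g f) (ℓL κ Φ t p D g f) (hL κ Φ t p D g f) (vL κ Φ t p D g f) (kgR κ Φ t p D mk) 0 (kgqY κ Φ t p D g f qxY) (kgWY κ Φ t p D g f (KS.WxYR κ Φ t p D mk g f WxY)) (kgNYv0 κ Φ t p D g f mk qxY WxY)) ≤ (kgSL (nL κ Φ t p D g f) (ℓL κ Φ t p D g f) (hL κ Φ t p D g f)) := by
  have HC := (kgYRows0_of κ Φ t p D g f mk qxY WxY hN hg)
  have HR := (kgYRows0_of κ Φ t p D g f mk qxY (KS.WxYR κ Φ t p D mk g f WxY) hN hg)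
  obtain ⟨hΔ0, hΔ⟩ := dm₁Y_R_le κ Φ t p D mk g f qxY WxY hN hg hg2 hf hWxY hWx
  have hm2 := HR.kgM₂Y_sub_mul_le HC le_rfl (kgWY_R_le κ Φ t p D mk g f WxY) (kgNYv0 κ Φ t p D g f mk qxY WxY)
  have hm2mono := HR.kgM₂Y_mono_qW le_rfl (kgWY_R_le κ Φ t p D mk g f WxY) (kgNYv0 κ Φ t p D g f mk qxY WxY)
  have hm2mono' : ((((kgM₂Y (nL κ Φ t p D g f) (ℓL κ Φ t p D g f) (hL κ Φ t p D g f) (vL κ Φ t p D g f) (kgR κ Φ t p D mk) 0 (kgqY κ Φ t p D g f qxY) (kgWY κ Φ t p D g f (KS.WxYR κ Φ t p D mk g f WxY)) (kgNYv0 κ Φ t p D g f mk qxY WxY))) : ℕ) : ℤ) ≤ ((((kgM₂Y (nL κ Φ t p D g f) (ℓL κ Φ t p D g f) (hL κ Φ t p D g f) (vL κ Φ t p D g f) (kgR κ Φ t p D mk) 0 (kgqY κ Φ t p D g f qxY) (kgWY κ Φ t p D g f WxY) (kgNYv0 κ Φ t p D g f mk qxY WxY))) : ℕ) : ℤ) :=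 by exact_mod_cast hm2mono
  obtain ⟨hKR, hKs, h958, hR1, hK, -⟩ := valsQ_floor κ Φ t p D g f mk hN hg hg2
  have hd2 : (kgDec₂Y (nL κ Φ t p D g f) (ℓL κ Φ t p D g f) (hL κ Φ t p D g f) (kgR κ Φ t p D mk) 0) = kgSLY (nL κ Φ t p D g f) (ℓL κ Φ t p D g f) (hL κ Φ t p D g f) - 2 * (((kgR κ Φ t p D mk) : ℕ) : ℤ) - ((0 : ℕ) : ℤ) := rfl
  have eσ : kgSLY (nL κ Φ t p D g f) (ℓL κ Φ t p D g f) (hL κ Φ t p D g f) = (kgSL (nL κ Φ t p D g f) (ℓL κ Φ t p D g f) (hL κ Φ t p D g f)) := rfl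
  have hR0 : (0 : ℤ) ≤ (((kgR κ Φ t p D mk) : ℕ) : ℤ) := by positivity
  have h1600s : 1600 * (((kgR κ Φ t p D mk) : ℕ) : ℤ) ≤ (kgSL (nL κ Φ t p D g f) (ℓL κ Φ t p D g f) (hL κ Φ t p D g f)) + 1 := by
    have : 1600 * (((KS0.R'0 κ Φ t p D mk) : ℕ) : ℤ) ≤ (kgSL (nL κ Φ t p D g f) (ℓL κ Φ t p D g f) (hL κ Φ t p D g f)) + 1 := by nlinarith
    exact this
  -- TY^C − TY^R = 2·Δm₁·(R + 0)
  have eT : (kgTY (nL κ Φ t p D g f) (ℓL κ Φ t p D g f) (hL κ Φ t p D g f) (vL κ Φ t p D g f) (kgR κ Φ t p D mk) 0 (kgqY κ Φ t p D g f qxY) (kgWY κ Φ t p D g f WxY) (kgNYv0 κ Φ t p D g f mk qxY WxY)) - (kgTY (nL κ Φ t p D g f) (ℓL κ Φ t p D g f) (hL κ Φ t p D g f) (vL κ Φ t p D g f) (kgR κ Φ t p D mk) 0 (kgqY κ Φ t p D g f qxY) (kgWY κ Φ t p D g f (KS.WxYR κ Φ t p D mk g f WxY)) (kgNYv0 κ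 Φ t p D g f mk qxY WxY)) = 2 * (((((kgM₁Y (nL κ Φ t p D g f) (vL κ Φ t p D g f) (kgR κ Φ t p D mk) 0 (kgWY κ Φ t p D g f WxY) (kgNYv0 κ Φ t p D g f mk qxY WxY))) : ℕ) : ℤ) - ((((kgM₁Y (nL κ Φ t p D g f) (vL κ Φ t p D g f) (kgR κ Φ t p D mk) 0 (kgWY κ Φ t p D g f (KS.WxYR κ Φ t p D mk g f WxY)) (kgNYv0 κ Φ t p D g f mk qxY WxY))) : ℕ) : ℤ)) * ((((kgR κ Φ t p D mk) : ℕ) : ℤ) + ((0 : ℕ) : ℤ)) := by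
    unfold kgTY; ring
  -- XY^C − XY^R = (Δm₁ + Δm₂)·(R + 0)
  have eX : (kgXY (nL κ Φ t p D g f) (ℓL κ Φ t p D g f) (hL κ Φ t p D g f) (vL κ Φ t p D g f) (kgR κ Φ t p D mk) 0 (kgqY κ Φ t p D g f qxY) (kgWY κ Φ t p D g f WxY) (kgNYv0 κ Φ t p D g f mk qxY WxY)) - (kgXY (nL κ Φ t p D g f) (ℓL κ Φ t p D g f) (hL κ Φ t p D g f) (vL κ Φ t p D g f) (kgR κ Φ t p D mk) 0 (kgqY κ Φ t p D g f qxY) (kgWY κ Φ t p D g f (KS.WxYR κ Φ t p D mk g f WxY)) (kgNYv0 κ Φ t p D g f mk qxY WxY)) = ((((((kgM₁Y (nL κ Φ t p D g f) (vL κ Φ t p D g f) (kgR κ Φ t p D mk) 0 (kgWY κ Φ t p D g f WxY) (kgNYv0 κ Φ t p D g f mk qxY WxY))) : ℕ) : ℤ) - ((((kgM₁Y (nL κ Φ t p D g f) (vL κ Φ t p D g f) (kgR κ Φ t p D mk) 0 (kgWY κ Φ t p D g f (KS.WxYR κ Φ t p D mk g f WxY)) (kgNYv0 κ Φ t p D g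 f mk qxY WxY))) : ℕ) : ℤ)) +
      (((((kgM₂Y (nL κ Φ t p D g f) (ℓL κ Φ t p D g f) (hL κ Φ t p D g f) (vL κ Φ t p D g f) (kgR κ Φ t p D mk) 0 (kgqY κ Φ t p D g f qxY) (kgWY κ Φ t p D g f WxY) (kgNYv0 κ Φ t p D g f mk qxY WxY))) : ℕ) : ℤ) - ((((kgM₂Y (nL κ Φ t p D g f) (ℓL κ Φ t p D g f) (hL κ Φ t p D g f) (vL κ Φ t p D g f) (kgR κ Φ t p D mk) 0 (kgqY κ Φ t p D g f qxY) (kgWY κ Φ t p D g f (KS.WxYR κ Φ t p D mk g f WxY)) (kgNYv0 κ Φ t p D g f mk qxY WxY))) : ℕ) : ℤ))) * ((((kgR κ Φ t p D mk) : ℕ) : ℤ) + ((0 : ℕ) : ℤ)) := by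
    unfold kgXY; ring
  rw [hd2, eσ, eT] at hm2
  push_cast at hm2
  set Δ₁ := ((((kgM₁Y (nL κ Φ t p D g f) (vL κ Φ t p D g f) (kgR κ Φ t p D mk) 0 (kgWY κ Φ t p D g f WxY) (kgNYv0 κ Φ t p D g f mk qxY WxY))) : ℕ) : ℤ) - ((((kgM₁Y (nL κ Φ t p D g f) (vL κ Φ t p D g f) (kgR κ Φ t p D mk) 0 (kgWY κ Φ t p D g f (KS.WxYR κ Φ t p D mk g f WxY)) (kgNYv0 κ Φ t p D g f mk qxY WxY))) : ℕ) : ℤ) with hΔ₁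
  set Δ₂ := ((((kgM₂Y (nL κ Φ t p D g f) (ℓL κ Φ t p D g f) (hL κ Φ t p D g f) (vL κ Φ t p D g f) (kgR κ Φ t p D mk) 0 (kgqY κ Φ t p D g f qxY) (kgWY κ Φ t p D g f WxY) (kgNYv0 κ Φ t p D g f mk qxY WxY))) : ℕ) : ℤ) - ((((kgM₂Y (nL κ Φ t p D g f) (ℓL κ Φ t p D g f) (hL κ Φ t p D g f) (vL κ Φ t p D g f) (kgR κ Φ t p D mk) 0 (kgqY κ Φ t p D g f qxY) (kgWY κ Φ t p D g f (KS.WxYR κ Φ t p D mk g f WxY)) (kgNYv0 κ Φ t p D g f mk qxY WxY))) : ℕ) : ℤ) with hΔ₂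
  have hΔ₂0 : 0 ≤ Δ₂ := by linarith
  have hm2' : ((kgSL (nL κ Φ t p D g f) (ℓL κ Φ t p D g f) (hL κ Φ t p D g f)) - 2 * (((kgR κ Φ t p D mk) : ℕ) : ℤ)) * Δ₂ ≤ 2 * Δ₁ * (((kgR κ Φ t p D mk) : ℕ) : ℤ) + ((kgSL (nL κ Φ t p D g f) (ℓL κ Φ t p D g f) (hL κ Φ t p D g f)) - 2 * (((kgR κ Φ t p D mk) : ℕ) : ℤ)) - 1 := by
    rw [hΔ₁, hΔ₂]; linarith
  have hprod : 2 * Δ₁ * (((kgR κ Φ t p D mk) : ℕ) : ℤ) ≤ 548 * (((kgR κ Φ t p D mk) : ℕ) : ℤ) := by nlinarith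
  have hpos : 0 < (kgSL (nL κ Φ t p D g f) (ℓL κ Φ t p D g f) (hL κ Φ t p D g f)) - 2 * (((kgR κ Φ t p D mk) : ℕ) : ℤ) := by linarith
  have hΔ₂1 : Δ₂ ≤ 1 := by
    have hlt : ((kgSL (nL κ Φ t p D g f) (ℓL κ Φ t p D g f) (hL κ Φ t p D g f)) - 2 * (((kgR κ Φ t p D mk) : ℕ) : ℤ)) * Δ₂ < ((kgSL (nL κ Φ t p D g f) (ℓL κ Φ t p D g f) (hL κ Φ t p D g f)) - 2 * (((kgR κ Φ t p D mk) : ℕ) : ℤ)) * 2 := by linarith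
    have := lt_of_mul_lt_mul_left hlt hpos.le
    linarith
  have hA : (Δ₁ + Δ₂) * (((kgR κ Φ t p D mk) : ℕ) : ℤ) ≤ 275 * (((kgR κ Φ t p D mk) : ℕ) : ℤ) := mul_le_mul_of_nonneg_right (by linarith) hR0
  have hB : 0 ≤ (Δ₁ + Δ₂) * (((kgR κ Φ t p D mk) : ℕ) : ℤ) := mul_nonneg (by linarith) hR0
  rw [eX]
  simp only [Nat.cast_zero, add_zero]
  exact ⟨hB, by linarith⟩

/-- **ALONG BOTTOM**: `arrLo₁^C − sL ≤ lo₁^R` for the root's y′-arrival box (`lo₁ = (N+1)·sL + XY − (P − 1)`, `XY^C − XY^R ≤ sL`). [this work] -/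
theorem rootBoxY_bottom_R (hN : EqNumL κ Φ t p D g f) (hg : gFloorKG κ Φ t p D mk ≤ g) (hg2 : 40 * Neg.K κ * KS0.R'0 κ Φ t p D mk ≤ g)
    (hf : KS.fxR0 κ Φ t p D mk ≤ f) (hWxY : KS.Rs t D mk + 34 * nL κ Φ t p D g f + 29 * KS0.R'0 κ Φ t p D mk + 2 ≤ WxY) (hWx : WxY ≤ 100 * nL κ Φ t p D g f) :
    ((kgYRows0_of κ Φ t p D g f mk qxY WxY hN hg).kgLastLoY (kgNYv0 κ Φ t p D g f mk qxY WxY)) 1 - (kgSL (nL κ Φ t p D g f) (ℓL κ Φ t p D g f) (hL κ Φ t p D g f)) ≤ ((kgYRows0_of κ Φ t p D g f mk qxY (KS.WxYR κ Φ t p D mk g f WxY) hN hg).kgLastLoY (kgNYv0 κ Φ t p D g f mk qxY WxY)) 1 := by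
  obtain ⟨-, hX⟩ := XY_sub_R_le κ Φ t p D mk g f qxY WxY hN hg hg2 hf hWxY hWx
  simp only [KGYRows.kgLastLoY, Matrix.cons_val_one, Matrix.cons_val_zero]
  linarith

end BoxY2

end KS

end NegB

end PlanarSkeletonFrm

end Summit.CriticalPhenomena.PercolationContinuityZ3.Theorems.Transplant

end
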